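import Summits.ValiantsHypothesis.ValiantsHypothesis.Theorems.KPlusLogSqLawTropicalPermutationChanges

/-!
# Route `KPlusLogSqLaw`, crux `TropicalB` — CLASS-UNIFORM valuations freeze the permutation

HONEST FRAMING.  Helper toward the registered stubs `stub_tropThin` / `stub_tropFat` of
`Cruxes/TropicalB/Lines/birth.lean` (crux `Summit.ValiantsHypothesis.ValiantsHypothesis.Theses.KPlusLogSqLaw.TropicalB`,
ledger item `stmt-ValiantsHypothesis-19771`, route `KPlusLogSqLaw`; cell `pub-symmetroid`, seat `val-sym-trop-p3`,
2026-08-26).  A located NO-GO row for the register census (companion of `…TropicalBSeparable`): nothing here bounds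
`TropicalB` for general designs, and nothing bears on `KPlusLogSqLaw`, `MatrixDescartes` or `VP ≠ VNP`.

A design is CLASS-UNIFORM if the class enters every valuation only through a class constant,
`v a b l = w a b + t l`, with FULL SUPPORT (`ε a b l ≠ 0`).  Then the weight of a term splits as
`(θ·Σ d(λᵢ) − Σ t(λᵢ)) − W(σ)` with `W(σ) = Σᵢ w (σ i) i`: the permutation part does not see the slope or the classes.
Hence a dominant term's permutation is the UNIQUE minimiser of `W` (`perm_eq_of_dominant_classUniform`: two dominant
terms — at any two slopes — have the same permutation), so along every chain only class flips happen and
`classUniform_chain_le : n ≤ m·(K−1)` (the permutation fibre, val-sym-lift-p2's `succ_le_card_perms_mul`);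
`classUniform_kPlusLogSq` records the crux's inequality (`C = 2`) on this degenerate class.
Located boundary: SEPARABLE designs (`…TropicalBSeparable`) have no permutation register at all; class-uniform ones
have a frozen permutation; SHIFT-THREE needs BOTH couplings (row–column via `pen(a − b)`, class–column via its price).
[folklore]
-/

set_option linter.dupNamespace false
set_option autoImplicit false

namespace Summit.ValiantsHypothesis.ValiantsHypothesis.Theorems.KPlusLogSqLaw

open Summit.ValiantsHypothesis.ValiantsHypothesis.Theorems.MatrixDescartes.Negative
open Summit.ValiantsHypothesis.ValiantsHypothesis.Theorems.LacunarySymmetroidMatrixDescartes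
open Summit.ValiantsHypothesis.ValiantsHypothesis.Theorems.LacunarySymmetroidMatrixDescartes.TropicalCensus
open scoped BigOperators
open Finset

section ClassUniform

variable {m K : ℕ}

/-- the weight of a term of a class-uniform design: class part minus the permutation cost `W(σ) = Σᵢ w (σ i) i`.
[folklore] -/
theorem tropWeight_classUniform (d : Fin K → ℕ) (v : Fin m → Fin m → Fin K → ℤ) (w : Fin m → Fin m → ℤ)
    (t : Fin K → ℤ) (hv : ∀ a b l, v a b l = w a b + t l) (θ : ℤ) (σ : Equiv.Perm (Fin m)) (μ : Fin m → Fin K) :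
    tropWeight d v θ (σ, μ) = (θ * ∑ i, (d (μ i) : ℤ) - ∑ i, t (μ i)) - ∑ i, w (σ i) i := by
  unfold tropWeight
  simp only [hv, sum_add_distrib]
  ring

/-- **Class-uniform valuations: a dominant permutation beats every other permutation's cost strictly.**  With full
support, if `(σ, μ)` is dominant then `Σᵢ w (σ i) i < Σᵢ w (σ' i) i` for every `σ' ≠ σ`. [folklore] -/
theorem cost_lt_of_dominant_classUniform (d : Fin K → ℕ) (v ε : Fin m → Fin m → Fin K → ℤ)
    (w : Fin m → Fin m → ℤ) (t : Fin K → ℤ) (hv : ∀ a b l, v a b l = w a b + t l) (hε : ∀ a b l, ε a b l ≠ 0)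
    (θ : ℤ) (σ : Equiv.Perm (Fin m)) (μ : Fin m → Fin K) (hp : IsDominant d v ε θ (σ, μ))
    (σ' : Equiv.Perm (Fin m)) (hσ : σ' ≠ σ) : ∑ i, w (σ i) i < ∑ i, w (σ' i) i := by
  have hne : (σ', μ) ≠ (σ, μ) := fun h => hσ (congrArg Prod.fst h)
  have hpres : termSign ε (σ', μ) ≠ 0 := by
    unfold termSign
    refine mul_ne_zero ?_ (prod_ne_zero_iff.mpr fun i _ => hε _ _ _)
    exact_mod_cast (Equiv.Perm.sign σ').ne_zero
  have hlt := hp.2 _ hne hpres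
  rw [tropWeight_classUniform d v w t hv, tropWeight_classUniform d v w t hv] at hlt
  linarith

/-- **Class-uniform valuations freeze the permutation**: two dominant terms (at any two slopes) have the same
permutation. [folklore] -/
theorem perm_eq_of_dominant_classUniform (d : Fin K → ℕ) (v ε : Fin m → Fin m → Fin K → ℤ)
    (w : Fin m → Fin m → ℤ) (t : Fin K → ℤ) (hv : ∀ a b l, v a b l = w a b + t l) (hε : ∀ a b l, ε a b l ≠ 0)
    {θ θ' : ℤ} {q q' : Equiv.Perm (Fin m) × (Fin m → Fin K)} (hq : IsDominant d v ε θ q)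
    (hq' : IsDominant d v ε θ' q') : q.1 = q'.1 := by
  by_contra hne
  have h1 := cost_lt_of_dominant_classUniform d v ε w t hv hε θ q.1 q.2 hq q'.1 (Ne.symm hne)
  have h2 := cost_lt_of_dominant_classUniform d v ε w t hv hε θ' q'.1 q'.2 hq' q.1 hne
  exact lt_asymm h1 h2

/-- **Class-uniform full-support designs: `n ≤ m·(K−1)`** along every sign-alternating dominant chain (one permutation,
only class flips: the permutation fibre `succ_le_card_perms_mul` of val-sym-lift-p2). [folklore] -/
theorem classUniform_chain_le (d : Fin K → ℕ) (v ε : Fin m → Fin m → Fin K → ℤ)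
    (w : Fin m → Fin m → ℤ) (t : Fin K → ℤ) (hv : ∀ a b l, v a b l = w a b + t l) (hε : ∀ a b l, ε a b l ≠ 0)
    {n : ℕ} (θ : Fin (n + 1) → ℤ) (p : Fin (n + 1) → Equiv.Perm (Fin m) × (Fin m → Fin K))
    (hθ : StrictMono θ) (hdom : ∀ k, IsDominant d v ε (θ k) (p k))
    (halt : ∀ k : Fin n, termSign ε (p k.castSucc) * termSign ε (p k.succ) < 0) : n ≤ m * (K - 1) := by
  classical
  have h := succ_le_card_perms_mul d v ε n θ p hθ hdom halt
  have himg : (univ.image fun k => (p k).1) = {(p 0).1} := by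
    ext σ
    simp only [mem_image, mem_univ, true_and, mem_singleton]
    constructor
    · rintro ⟨k, rfl⟩
      exact perm_eq_of_dominant_classUniform d v ε w t hv hε (hdom k) (hdom 0)
    · rintro rfl; exact ⟨0, rfl⟩
  rw [himg, card_singleton, one_mul] at h
  omega

/-- **Class-uniform full-support designs satisfy the crux's inequality with `C = 2`** (`m(K−1) ≤ 2^(K + log₂ m + 1)`).
HONEST RANGE: a degenerate class. [folklore] -/
theorem classUniform_kPlusLogSq (d : Fin K → ℕ) (v ε : Fin m → Fin m → Fin K → ℤ)
    (w : Fin m → Fin m → ℤ) (t : Fin K → ℤ) (hv : ∀ a b l, v a b l = w a b + t l) (hε : ∀ a b l, ε a b l ≠ 0)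
    {n : ℕ} (θ : Fin (n + 1) → ℤ) (p : Fin (n + 1) → Equiv.Perm (Fin m) × (Fin m → Fin K))
    (hθ : StrictMono θ) (hdom : ∀ k, IsDominant d v ε (θ k) (p k))
    (halt : ∀ k : Fin n, termSign ε (p k.castSucc) * termSign ε (p k.succ) < 0) :
    n ≤ 2 ^ (2 * (K + Nat.log 2 m ^ 2)) := by
  have h := classUniform_chain_le d v ε w t hv hε θ p hθ hdom halt
  rcases Nat.eq_zero_or_pos K with hK0 | hK0
  · subst hK0
    have : n ≤ 0 := by simpa using h
    exact this.trans (Nat.zero_le _)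
  set L := Nat.log 2 m with hL
  have hm : m < 2 ^ (L + 1) := hL ▸ Nat.lt_pow_succ_log_self (by norm_num) m
  have hK : K - 1 < 2 ^ K := lt_of_le_of_lt (Nat.sub_le K 1) Nat.lt_two_pow_self
  have h1 : m * (K - 1) ≤ 2 ^ (L + 1) * 2 ^ K := Nat.mul_le_mul hm.le hK.le
  have h2 : 2 ^ (L + 1) * 2 ^ K = 2 ^ (L + 1 + K) := (pow_add 2 _ _).symm
  have h3 : 2 ^ (L + 1 + K) ≤ 2 ^ (2 * (K + L ^ 2)) := Nat.pow_le_pow_right (by norm_num) (by nlinarith)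
  omega

end ClassUniform

end Summit.ValiantsHypothesis.ValiantsHypothesis.Theorems.KPlusLogSqLaw
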